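import Mathlib
import HarnessLib
import Literature.Analysis.FluidPDE.SelfSimilar
import Literature.Analysis.FluidPDE.VectorCalculus
import Literature.Analysis.FluidPDE.NSBoundedMildOseen
import Literature.Analysis.FluidPDE.SuitableWeak
import Literature.Analysis.FluidPDE.WeakSolution
import Literature.Analysis.FluidPDE.LocalTypeI
import Literature.Analysis.FluidPDE.LocalTypeISliceMorrey
import Literature.Analysis.UnboundedOperators.HeatKernel
import Summits.NavierStokesRegularity.NavierStokesRegularity.Theorems.LocalSineTubeDoorProfileAlignedWindowRigidityAncient

/-!
# `FilamentPinchDoor.FilamentaryGrowth` (stmt-NavierStokesRegularity-26431) — line `birth`,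
# stub `stub_sliceEnergyGrowth` PROVED: in the energy class EVERY slice has linear energy growth on balls

Registered stub of the skeleton of record (planner ns-idea-6 g3, `FilamentaryGrowth_birth.lean`,
sha c519b1d5…), with the statement `StubSliceEnergyGrowth` UNFOLDED verbatim, so the line's `sorry` at
`stub_sliceEnergyGrowth` closes by `exact …Theorems.FilamentPinchDoorFilamentaryGrowthStubSliceEnergyGrowth.stub_sliceEnergyGrowth`.

STATEMENT.  For a profile `v` of the route's class (Type-I rate `‖v(t,x)‖ ≤ C/√(−t)`, continuous on the open
slab `(−∞,0) × ℝ³`, Oseen-mild, divergence-free, suitable weak on the backward slab with a weak gradient `H`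
and Albritton–Barker's `𝐈 = typeIBound ((−∞,0) × ℝ³) v π H < ∞`), there is `A` with
`∫_{B(x,R)} ‖v(s,y)‖² dy ≤ A·R` for EVERY `s < 0`, every centre `x` and every radius `R > 0` (in `ℝ≥0∞` form).

PROOF.  `A = 𝐈.toReal`.  Fix `s < 0`, `x`, `R > 0` and put the vertex of a parabolic ball at
`t₀ = min 0 (s + R²/2)`, so that `s ∈ (t₀ − R², t₀)` and `Q((t₀,x),R) ⊆ (−∞,0) × ℝ³`; the tree's
`ae_energy_ball_le_typeIBound_at` (Albritton–Barker: the essential supremum in `A(Q') ≤ 𝐈`) gives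
`∫_{B(x,R)} ‖v(t)‖² ≤ R·𝐈` for a.e. `t ∈ (t₀ − R², t₀)`.  The map `t ↦ ∫_{B(x,R)} ‖v(t,y)‖² dy` is continuous
at `s` (dominated convergence: `v` is jointly continuous on the open slab and bounded by `|C|/√(−s/2)` for
`t < s/2`), and a bound holding a.e. on an open interval holds at every point of continuity inside it (open sets
have positive Lebesgue measure).  Only the rate, the continuity and `𝐈 < ∞` are used; `K` does not degrade as
`s → 0⁻` because `𝐈` is a supremum over ALL admissible parabolic balls.

HONEST FRAMING: a statement about HYPOTHETICAL blow-up profiles (the energy class of a putative Type-I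
singularity); nothing here bears on Navier–Stokes regularity; no summit statement is proved.
-/

noncomputable section

-- the summit and its single sub-problem share the name (CONVENTIONS §1), as in every Theorems file
set_option linter.dupNamespace false

namespace Summit.NavierStokesRegularity.NavierStokesRegularity.Theorems.FilamentPinchDoorFilamentaryGrowthStubSliceEnergyGrowth

open Set Function Filter MeasureTheory Metric Topology
open scoped ENNReal NNReal
open Literature.Analysis Literature.Analysis.FluidPDE
open Summit.NavierStokesRegularity.NavierStokesRegularity.Theorems.LocalSineTubeDoorProfileAlignedWindowRigidityAncient

variable {v : ℝ → EuclideanSpace ℝ (Fin 3) → EuclideanSpace ℝ (Fin 3)}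

/-- An `ℝ≥0∞`-valued function bounded by `c` almost everywhere on an open interval is bounded by `c` at
every point of the interval where it is continuous (the exceptional set would contain a ball, of positive
Lebesgue measure). [folklore] -/
theorem le_of_ae_restrict_Ioo_le_of_continuousAt {f : ℝ → ℝ≥0∞} {a b s : ℝ} {c : ℝ≥0∞}
    (hs : s ∈ Ioo a b) (hf : ∀ᵐ t ∂(volume.restrict (Ioo a b)), f t ≤ c)
    (hcont : ContinuousAt f s) : f s ≤ c := by
  by_contra h
  rw [not_le] at h
  have hU : f ⁻¹' Ioi c ∈ 𝓝 s := hcont.preimage_mem_nhds (isOpen_Ioi.mem_nhds h)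
  have hI : Ioo a b ∈ 𝓝 s := isOpen_Ioo.mem_nhds hs
  obtain ⟨ε, hε, hball⟩ := Metric.mem_nhds_iff.1 (inter_mem hU hI)
  have hf' : ∀ᵐ t ∂(volume : Measure ℝ), t ∈ Ioo a b → f t ≤ c := (ae_restrict_iff' measurableSet_Ioo).1 hf
  have hnull : volume {t : ℝ | ¬ (t ∈ Ioo a b → f t ≤ c)} = 0 := ae_iff.1 hf'
  have hsub : ball s ε ⊆ {t : ℝ | ¬ (t ∈ Ioo a b → f t ≤ c)} := by
    intro t ht
    have h1 := hball ht
    exact fun himp => absurd (himp h1.2) (not_le.2 h1.1)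
  have h0 : volume (ball s ε) = 0 := measure_mono_null hsub hnull
  rw [Real.volume_ball] at h0
  have : 2 * ε ≤ 0 := ENNReal.ofReal_eq_zero.1 h0
  linarith

/-- **Continuity in time of the local energy of a slice**: for a field with the Type-I rate, continuous on
the open slab, `t ↦ ∫_{B(x,R)} ‖v(t,y)‖² dy` (as a lower Lebesgue integral in `ℝ≥0∞`) is continuous at every
`s < 0` (dominated convergence; the rate bounds `v` uniformly for `t < s/2`). [folklore] -/
theorem continuousAt_lintegral_ball_enorm_sq {C : ℝ} (hrate : HasTypeITimeDecay C v)
    (hcont : ContinuousOn (uncurry v) (Iio (0 : ℝ) ×ˢ univ)) {s : ℝ} (hs : s < 0)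
    (x : EuclideanSpace ℝ (Fin 3)) (R : ℝ) :
    ContinuousAt (fun t => ∫⁻ y in ball x R, ‖v t y‖ₑ ^ 2) s := by
  have hδ : 0 < -(s / 2) := by linarith
  obtain ⟨B, hbd⟩ := bdd_of_hasTypeITimeDecay hrate (-(s / 2)) hδ
  have hnhds : Iio (s / 2) ∈ 𝓝 s := Iio_mem_nhds (by linarith)
  refine tendsto_lintegral_filter_of_dominated_convergence (fun _ => ENNReal.ofReal B ^ 2) ?_ ?_ ?_ ?_
  · filter_upwards [hnhds] with t ht
    have ht0 : t < 0 := by simp only [mem_Iio] at ht; linarith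
    exact (continuous_slice hcont ht0).measurable.enorm.pow_const 2
  · filter_upwards [hnhds] with t ht
    refine Eventually.of_forall fun y => ?_
    have h1 : ‖v t y‖ ≤ B := hbd t (by simp only [mem_Iio] at ht; linarith) y
    have h2 : ‖v t y‖ₑ ≤ ENNReal.ofReal B := by
      rw [← ofReal_norm]
      exact ENNReal.ofReal_le_ofReal h1
    gcongr
  · rw [setLIntegral_const]
    exact ENNReal.mul_ne_top (ENNReal.pow_ne_top ENNReal.ofReal_ne_top) measure_ball_lt_top.ne
  · refine Eventually.of_forall fun y => ?_
    have h1 : ContinuousAt (uncurry v) (s, y) :=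
      hcont.continuousAt (prod_mem_nhds (Iio_mem_nhds hs) univ_mem)
    have h2 : ContinuousAt (fun t : ℝ => (t, y)) s := (continuous_id.prodMk continuous_const).continuousAt
    have h3 : ContinuousAt (fun t : ℝ => v t y) s := h1.comp_of_eq h2 rfl
    have h4 : Continuous fun a : EuclideanSpace ℝ (Fin 3) => ‖a‖ₑ ^ 2 :=
      (ENNReal.continuous_pow 2).comp continuous_enorm
    exact (h4.tendsto _).comp h3

/-- **The slice Morrey bound at EVERY negative time.**  If `𝐈((−∞,0) × ℝ³) ≤ M` then for every `s < 0`,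
every centre `x` and every `R > 0`, `∫_{B(x,R)} ‖v(s)‖² ≤ R · M`: Albritton–Barker's `A(Q((t₀,x),R)) ≤ 𝐈`
at the vertex `t₀ = min 0 (s + R²/2)` bounds almost every slice of `(t₀ − R², t₀) ∋ s`, and the local energy
is continuous in time at `s`. [cite: AlbrittonBarker2019, §1 after Thm 1.1 (displays defining A and 𝐈(ω))] -/
theorem lintegral_ball_enorm_sq_le {C : ℝ} (hrate : HasTypeITimeDecay C v)
    (hcont : ContinuousOn (uncurry v) (Iio (0 : ℝ) ×ˢ univ))
    {π : ℝ → EuclideanSpace ℝ (Fin 3) → ℝ}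
    {H : ℝ → EuclideanSpace ℝ (Fin 3) → EuclideanSpace ℝ (Fin 3) →L[ℝ] EuclideanSpace ℝ (Fin 3)}
    {M : ℝ≥0∞} (hI : typeIBound (Iio (0 : ℝ) ×ˢ (univ : Set (EuclideanSpace ℝ (Fin 3)))) v π H ≤ M)
    {s : ℝ} (hs : s < 0) (x : EuclideanSpace ℝ (Fin 3)) {R : ℝ} (hR : 0 < R) :
    ∫⁻ y in ball x R, ‖v s y‖ₑ ^ 2 ≤ ENNReal.ofReal R * M := by
  set t₀ : ℝ := min 0 (s + R ^ 2 / 2) with ht₀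
  have ht₀0 : t₀ ≤ 0 := min_le_left _ _
  have hR2 : 0 < R ^ 2 := by positivity
  have hst₀ : s < t₀ := lt_min hs (by linarith)
  have ht₀s : t₀ - R ^ 2 < s := by
    have : t₀ ≤ s + R ^ 2 / 2 := min_le_right _ _
    linarith
  have hω : FluidPDE.parabolicCylinder R (t₀, x) ⊆
      Iio (0 : ℝ) ×ˢ (univ : Set (EuclideanSpace ℝ (Fin 3))) := by
    intro w hw
    rw [FluidPDE.mem_parabolicCylinder] at hw
    exact mem_prod.2 ⟨lt_of_lt_of_le hw.1.2 ht₀0, mem_univ _⟩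
  have hae := ae_energy_ball_le_typeIBound_at (u := v) (p := π) (G := H) hR t₀ x hω
  have hR0 : ENNReal.ofReal R ≠ 0 := by
    rw [ne_eq, ENNReal.ofReal_eq_zero, not_le]; exact hR
  have hae' : ∀ᵐ t ∂(volume.restrict (Ioo (t₀ - R ^ 2) t₀)),
      ∫⁻ y in ball x R, ‖v t y‖ₑ ^ 2 ≤ ENNReal.ofReal R * M := by
    filter_upwards [hae] with t ht
    calc ∫⁻ y in ball x R, ‖v t y‖ₑ ^ 2
        = ENNReal.ofReal R * ((ENNReal.ofReal R)⁻¹ * ∫⁻ y in ball x R, ‖v t y‖ₑ ^ 2) := by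
          rw [← mul_assoc, ENNReal.mul_inv_cancel hR0 ENNReal.ofReal_ne_top, one_mul]
      _ ≤ ENNReal.ofReal R * M := mul_le_mul' le_rfl (ht.trans hI)
  exact le_of_ae_restrict_Ioo_le_of_continuousAt ⟨ht₀s, hst₀⟩ hae'
    (continuousAt_lintegral_ball_enorm_sq hrate hcont hs x R)

/-- **Stub `stub_sliceEnergyGrowth` of line `birth` (crux `FilamentaryGrowth`, stmt-26431), statement
`StubSliceEnergyGrowth` unfolded VERBATIM**: in the energy class (suitable on the backward slab, `𝐈 < ∞`) EVERY
slice has linear energy growth on balls, `∫_{B(x,R)} ‖v(s)‖² ≤ A·R` for all `s < 0`, `x`, `R > 0`, with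
`A = 𝐈.toReal` (the a.e.-in-time slice Morrey bound of Albritton–Barker upgraded to every slice by continuity of
the profile).  The Oseen-mild identity, divergence-freeness, suitability and the weak gradient are carried but not
used beyond `𝐈`. [cite: AlbrittonBarker2019, §1 after Thm 1.1 (A(Q') ≤ 𝐈(ω) for every admissible parabolic ball)] -/
theorem stub_sliceEnergyGrowth : ∀ (C : ℝ) (v : ℝ → EuclideanSpace ℝ (Fin 3) → EuclideanSpace ℝ (Fin 3)) (π : ℝ → EuclideanSpace ℝ (Fin 3) → ℝ) (H : ℝ → EuclideanSpace ℝ (Fin 3) → EuclideanSpace ℝ (Fin 3) →L[ℝ] EuclideanSpace ℝ (Fin 3)), Literature.Analysis.FluidPDE.HasTypeITimeDecay C v → ContinuousOn (Function.uncurry v) (Set.Iio (0 : ℝ) ×ˢ Set.univ) → (∀ s t : ℝ, s < t → t < 0 → ∀ x, v t x = Literature.Analysis.UnboundedOperators.heatExtension (v s) (t - s) x - Literature.Analysis.FluidPDE.oseenDuhamel 1 s v v t x) → (∀ t < 0, Literature.Analysis.FluidPDE.VectorCalculus.IsDivFree (v t)) → Literature.Analysis.FluidPDE.IsSuitableWeakSolutionOn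 (Literature.Analysis.FluidPDE.slab (EuclideanSpace ℝ (Fin 3)) (Set.Iio (0 : ℝ)) isOpen_Iio) 1 0 v π → Literature.Analysis.FluidPDE.HasWeakSpatialGradientOn (Literature.Analysis.FluidPDE.slab (EuclideanSpace ℝ (Fin 3)) (Set.Iio (0 : ℝ)) isOpen_Iio) v H → Literature.Analysis.FluidPDE.typeIBound (Set.Iio (0 : ℝ) ×ˢ Set.univ) v π H < ⊤ → (∃ A : ℝ, ∀ s < 0, ∀ (x : EuclideanSpace ℝ (Fin 3)) (R : ℝ), 0 < R → ∫⁻ y in Metric.ball x R, ENNReal.ofReal (‖v s y‖ ^ 2) ≤ ENNReal.ofReal (A * R)) := by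
  intro C v π H hrate hcont _ _ _ _ hI
  set M := Literature.Analysis.FluidPDE.typeIBound (Set.Iio (0 : ℝ) ×ˢ Set.univ) v π H with hM
  have hMtop : M ≠ ⊤ := hI.ne
  refine ⟨M.toReal, fun s hs x R hR => ?_⟩
  have h := lintegral_ball_enorm_sq_le (M := M) hrate hcont le_rfl hs x hR
  have h1 : ∀ y, ENNReal.ofReal (‖v s y‖ ^ 2) = ‖v s y‖ₑ ^ 2 := fun y => by
    rw [ENNReal.ofReal_pow (norm_nonneg _), ofReal_norm]
  simp_rw [h1]
  calc ∫⁻ y in ball x R, ‖v s y‖ₑ ^ 2 ≤ ENNReal.ofReal R * M := h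
    _ = ENNReal.ofReal (M.toReal * R) := by
        rw [ENNReal.ofReal_mul ENNReal.toReal_nonneg, ENNReal.ofReal_toReal hMtop, mul_comm]

end Summit.NavierStokesRegularity.NavierStokesRegularity.Theorems.FilamentPinchDoorFilamentaryGrowthStubSliceEnergyGrowth

end
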